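import Literature.Analysis.FluidPDE.NormalisedPressureSmooth
import Literature.Analysis.FluidPDE.NewtonPotentialGradient
import HarnessLib

/-!
# Perturbation of the pressure: `p̃[v] - p̃[w]` and `∇p̃[v] - ∇p̃[w]` through the sources

Analysis/FluidPDE support file (everything proved; no definitions, no named facts), serving the
formalisation of Scheffer's singular weak solutions of the Navier–Stokes inequality in the
presentation of W. S. Ożański, arXiv:1709.00602v4, Appendix A.3 ("Some continuity properties of `p[v,f]` and
`u[v,f]` with respect to `f`"), its first lemma (held plain-text rendering: §8.3, "Lemma 23"; Scheffer, Comm. Math. Phys. 101 (1985), the continuity step of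
Lemma 3.2): "`∇p*[v_k,f_k](x) - ∇p*[v_k,f](x) = (4π)⁻¹ ∫ (F_k(y) - G_k(y)) (x-y)/|x-y|³ dy`
[`F_k`, `G_k` the sources `Σ∂ᵢuⱼ∂ⱼuᵢ` of the two fields] … we immediately obtain that
`∇p*[v_k,f_k] - ∇p*[v_k,f] → 0` uniformly on `ℝ³`" from `F_k - G_k → 0` uniformly with
supports in a fixed compact set. This is the generic, vocabulary-free half of that lemma, for
the tree's normalised pressure `p̃[v] = normalisedPressure v = -Δ⁻¹∂ᵢ∂ⱼ(vᵢvⱼ)` and source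
`G[v] = pressureSource v = ∂ᵢ∂ⱼ(vᵢvⱼ)` (`= Σ∂ᵢvⱼ∂ⱼvᵢ` for divergence-free `v`):

* `normalisedPressure_eq_neg_integral_newtonKernel_mul` — `p̃[v](x) = -∫ Γ(x-y) G[v](y) dy`
  (`Γ(z) = -1/(4π|z|)`; the tree's Newtonian representation (3.3), resigned);
* `normalisedPressure_sub_eq_neg_integral` — `p̃[v] - p̃[w] = -∫ Γ(x-y)(G[v] - G[w])(y) dy`;
* `abs_normalisedPressure_sub_le` — `|p̃[v](x) - p̃[w](x)| ≤ B + (4π)⁻¹‖G[v] - G[w]‖_{L¹}` for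
  `|G[v] - G[w]| ≤ B`;
* `norm_fderiv_normalisedPressure_sub_le` — `‖∇p̃[v](x) - ∇p̃[w](x)‖ ≤ B₁ +
  (4π)⁻¹‖∇(G[v] - G[w])‖_{L¹}` for `‖∇(G[v] - G[w])‖ ≤ B₁` (the derivative is moved onto the
  smooth compactly supported source difference, `fderiv_integral_newtonKernel_mul_apply`; one
  derivative more on the data than in the printed kernel `(x-y)/|x-y|³`, which is all the
  application needs since there the sources converge with all derivatives, Ożański (4.23));
* `abs_normalisedPressure_sub_le_of_subset`, `norm_fderiv_normalisedPressure_sub_le_of_subset` —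
  the same with the `L¹` norms absorbed: if both fields are supported in `B̄(0,R)` then
  `|p̃[v] - p̃[w]| ≤ (1 + (4π)⁻¹|B̄(0,R)|) B` and `‖∇p̃[v] - ∇p̃[w]‖ ≤ (1 + (4π)⁻¹|B̄(0,R)|) B₁`
  uniformly on `ℝ³` — the printed "uniformly on `ℝ³`" with an explicit modulus.

## Mathlib search

`MeasureTheory.integral_sub`, `MeasureTheory.norm_setIntegral_le_of_norm_le_const`,
`MeasureTheory.setIntegral_eq_integral_of_forall_compl_eq_zero`, `fderiv_sub` (used); tree:
`normalisedPressure_eq_integral_newton` (`NormalisedPressureFarField`),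
`abs_integral_newtonKernel_mul_le`, `norm_fderiv_integral_newtonKernel_mul_le`
(`NewtonPotentialGradient`), `integrable_newtonKernel_mul` (`NormalisedPressureL2Bound`).

## References

* W. S. Ożański, *On weak solutions to the Navier–Stokes inequality with internal
  singularities*, arXiv:1709.00602v4, Appendix A.3 (first lemma; held rendering: §8.3,
  Lemma 23) and §3.2 (3.3). [`Ozanski2017NSISingular`]
* V. Scheffer, *A solution to the Navier–Stokes inequality with an internal singularity*,
  Comm. Math. Phys. 101 (1985), (1.4) and Lemma 3.2 ((3.42)–(3.55)). [`Scheffer1985`]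
* D. Gilbarg, N. S. Trudinger, *Elliptic partial differential equations of second order*
  (2001), Lemma 4.1. [`GilbargTrudinger2001`]
-/

noncomputable section

open MeasureTheory Set Filter Metric Topology Function Real
open scoped ContDiff ENNReal

namespace Literature.Analysis.FluidPDE

variable {v w : EuclideanSpace ℝ (Fin 3) → EuclideanSpace ℝ (Fin 3)}

/-! ### The difference of two pressures as a Newtonian potential -/

/-- The source of a `C²` field is continuous. [folklore] -/
theorem continuous_pressureSource (hv : ContDiff ℝ 2 v) : Continuous (pressureSource v) :=
  (contDiff_pressureSource (n := 0) (by exact_mod_cast hv)).continuous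

/-- **`p̃[v](x) = -∫ Γ(x-y) G[v](y) dy`** for `v ∈ C²_c` (the Newtonian representation
`p̃[v](x) = ∫ G[v](y)/(4π|x-y|) dy`, Ożański (3.3), written with the tree's kernel
`Γ(z) = -1/(4π|z|)`). [cite: Ozanski2017NSISingular, §3.2 (3.3)] -/
theorem normalisedPressure_eq_neg_integral_newtonKernel_mul (hv : ContDiff ℝ 2 v)
    (hc : HasCompactSupport v) (x : EuclideanSpace ℝ (Fin 3)) :
    normalisedPressure v x = -∫ y, newtonKernel (x - y) * pressureSource v y := by
  rw [normalisedPressure_eq_integral_newton hv hc x, ← integral_neg]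
  refine integral_congr_ae (Eventually.of_forall fun y => ?_)
  simp only [newtonKernel_eq]
  ring

/-- **The difference of two pressures is the Newtonian potential of the difference of the
sources**: `p̃[v](x) - p̃[w](x) = -∫ Γ(x-y) (G[v](y) - G[w](y)) dy` (Ożański, App. A.3, proof of the first lemma:
"`∇p*[v_k,f_k](x) - ∇p*[v_k,f](x) = (4π)⁻¹∫ (F_k(y) - G_k(y)) (x-y)/|x-y|³ dy`", before
differentiation). [cite: Ozanski2017NSISingular, App. A.3, first lemma (held: Lemma 23), proof] -/
theorem normalisedPressure_sub_eq_neg_integral (hv : ContDiff ℝ 2 v) (hcv : HasCompactSupport v)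
    (hw : ContDiff ℝ 2 w) (hcw : HasCompactSupport w) (x : EuclideanSpace ℝ (Fin 3)) :
    normalisedPressure v x - normalisedPressure w x =
      -∫ y, newtonKernel (x - y) * (pressureSource v y - pressureSource w y) := by
  have iv := integrable_newtonKernel_mul (continuous_pressureSource hv)
    (hasCompactSupport_pressureSource hcv) x
  have iw := integrable_newtonKernel_mul (continuous_pressureSource hw)
    (hasCompactSupport_pressureSource hcw) x
  rw [normalisedPressure_eq_neg_integral_newtonKernel_mul hv hcv,
    normalisedPressure_eq_neg_integral_newtonKernel_mul hw hcw, neg_sub_neg, ← integral_sub iw iv,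
    ← neg_neg (∫ y, (newtonKernel (x - y) * pressureSource w y -
      newtonKernel (x - y) * pressureSource v y)), ← integral_neg]
  congr 1
  refine integral_congr_ae (Eventually.of_forall fun y => ?_)
  ring

/-- The difference of the sources of two compactly supported fields is compactly supported.
[folklore] -/
theorem hasCompactSupport_pressureSource_sub (hcv : HasCompactSupport v)
    (hcw : HasCompactSupport w) :
    HasCompactSupport fun y => pressureSource v y - pressureSource w y :=
  (hasCompactSupport_pressureSource hcv).sub (hasCompactSupport_pressureSource hcw)

/-! ### Sup bounds -/

/-- **`|p̃[v](x) - p̃[w](x)| ≤ B + (4π)⁻¹ ‖G[v] - G[w]‖_{L¹}`** whenever `|G[v] - G[w]| ≤ B`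
(`v, w ∈ C²_c`). [cite: Ozanski2017NSISingular, App. A.3, first lemma (held: Lemma 23), proof] -/
theorem abs_normalisedPressure_sub_le (hv : ContDiff ℝ 2 v) (hcv : HasCompactSupport v)
    (hw : ContDiff ℝ 2 w) (hcw : HasCompactSupport w) {B : ℝ}
    (hB : ∀ y, |pressureSource v y - pressureSource w y| ≤ B) (x : EuclideanSpace ℝ (Fin 3)) :
    |normalisedPressure v x - normalisedPressure w x| ≤
      B + (4 * π)⁻¹ * ∫ y, |pressureSource v y - pressureSource w y| := by
  rw [normalisedPressure_sub_eq_neg_integral hv hcv hw hcw x, abs_neg]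
  exact abs_integral_newtonKernel_mul_le ((continuous_pressureSource hv).sub
    (continuous_pressureSource hw)) (hasCompactSupport_pressureSource_sub hcv hcw) hB x

/-- The two pressures of `C^∞_c` fields differ by a smooth function whose derivative is the
difference of the derivatives. [folklore] -/
theorem fderiv_normalisedPressure_sub (hv : ContDiff ℝ ∞ v) (hcv : HasCompactSupport v)
    (hw : ContDiff ℝ ∞ w) (hcw : HasCompactSupport w) (x : EuclideanSpace ℝ (Fin 3)) :
    fderiv ℝ (normalisedPressure v) x - fderiv ℝ (normalisedPressure w) x =
      -fderiv ℝ (fun x' => ∫ y, newtonKernel (x' - y) * (pressureSource v y - pressureSource w y))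
        x := by
  have hdv : Differentiable ℝ (normalisedPressure v) :=
    (contDiff_normalisedPressure_of_contDiff_infty hv hcv).differentiable (by simp)
  have hdw : Differentiable ℝ (normalisedPressure w) :=
    (contDiff_normalisedPressure_of_contDiff_infty hw hcw).differentiable (by simp)
  have heq : (fun x' => normalisedPressure v x' - normalisedPressure w x') = fun x' =>
      -∫ y, newtonKernel (x' - y) * (pressureSource v y - pressureSource w y) :=
    funext fun x' => normalisedPressure_sub_eq_neg_integral (hv.of_le (by decide)) hcv
      (hw.of_le (by decide)) hcw x'
  rw [← fderiv_fun_sub (hdv x) (hdw x), heq, fderiv_fun_neg]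

/-- **`‖∇p̃[v](x) - ∇p̃[w](x)‖ ≤ B₁ + (4π)⁻¹ ‖∇(G[v] - G[w])‖_{L¹}`** whenever
`‖∇(G[v] - G[w])‖ ≤ B₁` (`v, w ∈ C^∞_c`; the derivative falls on the source difference).
[cite: Ozanski2017NSISingular, App. A.3, first lemma (held: Lemma 23), proof] -/
theorem norm_fderiv_normalisedPressure_sub_le (hv : ContDiff ℝ ∞ v) (hcv : HasCompactSupport v)
    (hw : ContDiff ℝ ∞ w) (hcw : HasCompactSupport w) {B₁ : ℝ}
    (hB₁ : ∀ y, ‖fderiv ℝ (fun y' => pressureSource v y' - pressureSource w y') y‖ ≤ B₁)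
    (x : EuclideanSpace ℝ (Fin 3)) :
    ‖fderiv ℝ (normalisedPressure v) x - fderiv ℝ (normalisedPressure w) x‖ ≤
      B₁ + (4 * π)⁻¹ * ∫ y, ‖fderiv ℝ (fun y' => pressureSource v y' - pressureSource w y') y‖ := by
  rw [fderiv_normalisedPressure_sub hv hcv hw hcw x, norm_neg]
  exact norm_fderiv_integral_newtonKernel_mul_le
    ((contDiff_pressureSource (n := ⊤) hv).sub (contDiff_pressureSource (n := ⊤) hw))
    (hasCompactSupport_pressureSource_sub hcv hcw) hB₁ x

/-! ### Uniform bounds when the supports lie in a fixed ball -/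

/-- An `L¹` norm of a function bounded by `B` and vanishing off `B̄(0,R)` is at most
`B |B̄(0,R)|`. [folklore] -/
theorem integral_norm_le_mul_measureReal {F : Type*} [NormedAddCommGroup F]
    {g : EuclideanSpace ℝ (Fin 3) → F} {R B : ℝ}
    (hsupp : ∀ y, y ∉ closedBall (0 : EuclideanSpace ℝ (Fin 3)) R → g y = 0)
    (hB : ∀ y, ‖g y‖ ≤ B) :
    ∫ y, ‖g y‖ ≤ B * volume.real (closedBall (0 : EuclideanSpace ℝ (Fin 3)) R) := by
  rw [← setIntegral_eq_integral_of_forall_compl_eq_zero (s := closedBall 0 R)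
    (fun y hy => by rw [hsupp y hy, norm_zero])]
  have h := norm_setIntegral_le_of_norm_le_const (f := fun y => ‖g y‖) (s := closedBall 0 R)
    (μ := volume) (C := B) measure_closedBall_lt_top (fun y _ => by rw [norm_norm]; exact hB y)
  exact (le_abs_self _).trans ((Real.norm_eq_abs _).symm.le.trans h)

/-- Off `B̄(0,R) ⊇ supp v ∪ supp w` the source difference vanishes. [folklore] -/
theorem pressureSource_sub_eq_zero_of_notMem {R : ℝ}
    (hsv : tsupport v ⊆ closedBall (0 : EuclideanSpace ℝ (Fin 3)) R)
    (hsw : tsupport w ⊆ closedBall (0 : EuclideanSpace ℝ (Fin 3)) R)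
    {y : EuclideanSpace ℝ (Fin 3)} (hy : y ∉ closedBall (0 : EuclideanSpace ℝ (Fin 3)) R) :
    pressureSource v y - pressureSource w y = 0 := by
  rw [pressureSource_apply_eq_zero_of_notMem_tsupport fun h => hy (hsv h),
    pressureSource_apply_eq_zero_of_notMem_tsupport fun h => hy (hsw h), sub_zero]

/-- **Uniform sup bound** (Ożański, App. A.3, first lemma: supports in a fixed compact set): for
`v, w ∈ C²_c` supported in `B̄(0,R)` with `|G[v] - G[w]| ≤ B`,
`|p̃[v](x) - p̃[w](x)| ≤ (1 + (4π)⁻¹|B̄(0,R)|) B` for every `x`.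
[cite: Ozanski2017NSISingular, App. A.3, first lemma (held: Lemma 23)] -/
theorem abs_normalisedPressure_sub_le_of_subset (hv : ContDiff ℝ 2 v) (hcv : HasCompactSupport v)
    (hw : ContDiff ℝ 2 w) (hcw : HasCompactSupport w) {R : ℝ}
    (hsv : tsupport v ⊆ closedBall (0 : EuclideanSpace ℝ (Fin 3)) R)
    (hsw : tsupport w ⊆ closedBall (0 : EuclideanSpace ℝ (Fin 3)) R) {B : ℝ}
    (hB : ∀ y, |pressureSource v y - pressureSource w y| ≤ B) (x : EuclideanSpace ℝ (Fin 3)) :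
    |normalisedPressure v x - normalisedPressure w x| ≤
      (1 + (4 * π)⁻¹ * volume.real (closedBall (0 : EuclideanSpace ℝ (Fin 3)) R)) * B := by
  have h1 := abs_normalisedPressure_sub_le hv hcv hw hcw hB x
  have h2 : ∫ y, |pressureSource v y - pressureSource w y| ≤
      B * volume.real (closedBall (0 : EuclideanSpace ℝ (Fin 3)) R) := by
    have := integral_norm_le_mul_measureReal (g := fun y => pressureSource v y - pressureSource w y)
      (fun y hy => pressureSource_sub_eq_zero_of_notMem hsv hsw hy)
      (fun y => by rw [Real.norm_eq_abs]; exact hB y)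
    simpa only [Real.norm_eq_abs] using this
  have h3 : 0 ≤ (4 * π)⁻¹ := by positivity
  nlinarith [mul_le_mul_of_nonneg_left h2 h3]

/-- **Uniform gradient bound** (Ożański, App. A.3, first lemma, conclusion "uniformly on `ℝ³`",
in quantitative form): for `v, w ∈ C^∞_c` supported in `B̄(0,R)` with `‖∇(G[v] - G[w])‖ ≤ B₁`,
`‖∇p̃[v](x) - ∇p̃[w](x)‖ ≤ (1 + (4π)⁻¹|B̄(0,R)|) B₁` for every `x`.
[cite: Ozanski2017NSISingular, App. A.3, first lemma (held: Lemma 23)] -/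
theorem norm_fderiv_normalisedPressure_sub_le_of_subset (hv : ContDiff ℝ ∞ v)
    (hcv : HasCompactSupport v) (hw : ContDiff ℝ ∞ w) (hcw : HasCompactSupport w) {R : ℝ}
    (hsv : tsupport v ⊆ closedBall (0 : EuclideanSpace ℝ (Fin 3)) R)
    (hsw : tsupport w ⊆ closedBall (0 : EuclideanSpace ℝ (Fin 3)) R) {B₁ : ℝ}
    (hB₁ : ∀ y, ‖fderiv ℝ (fun y' => pressureSource v y' - pressureSource w y') y‖ ≤ B₁)
    (x : EuclideanSpace ℝ (Fin 3)) :
    ‖fderiv ℝ (normalisedPressure v) x - fderiv ℝ (normalisedPressure w) x‖ ≤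
      (1 + (4 * π)⁻¹ * volume.real (closedBall (0 : EuclideanSpace ℝ (Fin 3)) R)) * B₁ := by
  have h1 := norm_fderiv_normalisedPressure_sub_le hv hcv hw hcw hB₁ x
  -- the derivative of the source difference vanishes off the closed ball (it vanishes on the
  -- open complement)
  have hzero : ∀ y, y ∉ closedBall (0 : EuclideanSpace ℝ (Fin 3)) R →
      fderiv ℝ (fun y' => pressureSource v y' - pressureSource w y') y = 0 := by
    intro y hy
    have hopen : IsOpen (closedBall (0 : EuclideanSpace ℝ (Fin 3)) R)ᶜ := isClosed_closedBall.isOpen_compl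
    have hev : (fun y' => pressureSource v y' - pressureSource w y') =ᶠ[𝓝 y] fun _ => 0 := by
      filter_upwards [hopen.mem_nhds hy] with y' hy'
      exact pressureSource_sub_eq_zero_of_notMem hsv hsw hy'
    rw [hev.fderiv_eq, fderiv_const_apply]
  have h2 : ∫ y, ‖fderiv ℝ (fun y' => pressureSource v y' - pressureSource w y') y‖ ≤
      B₁ * volume.real (closedBall (0 : EuclideanSpace ℝ (Fin 3)) R) :=
    integral_norm_le_mul_measureReal hzero hB₁
  have h3 : 0 ≤ (4 * π)⁻¹ := by positivity
  nlinarith [mul_le_mul_of_nonneg_left h2 h3]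

end Literature.Analysis.FluidPDE

end
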